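/-
Copyright (c) 2026 the pub-hodgecm-mathlib formalisation cell (harness21).  Prover seat hodgecm-mathlib-LH4-p07 (g7), Track A «(D-RAM) FOUR-FRAME», unit U2H, the census leaf
(ρ2b′-X) `stub_U2H_fixedPointCensus_typeTwo_unit0` — seam S2′-R «RAMIFIED THIRD-FIELD PACKAGE», the RamM ADAPTER (LH4-p12 (g5) 06:20:37Z hand; payer LH4-p14 (g4) MAP v2 S6-RM):
the third-field binder block of the ★ T5c rows of type RamM, PRODUCED from the one-field frame by ★ `exists_valuedFixedField_ramified`.  2026-09-04.
-/
import Literature.NumberTheory.LocalFields.ValuedFixedFieldRamified        -- ★ p857876 S2′-R (LH4-p12 (g5)) `exists_valuedFixedField_ramified`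
import Literature.NumberTheory.Automorphic.UnitaryThreeFourFrameDefs        -- ★ `IsRamifiedQuadraticDatum`
import HarnessLib

/-!
# T5c at the frame, type RamM: the third-field package at the T5c letters (S2′-R adapter)

The ★ T5c heads of the M∕E-ramified toric level census (LH4-p06: `…RamM.ncard_levelSet_eq_explicit_even∕odd_of_ramified`, `…_zero_eq_explicit_…`,
`…RamMTop.ncard_levelSetDep_top_eq_explicit_even∕odd∕low_of_ramified`, the (D3-LAW) organs of `…RamMTopLawPack` ∕ `…RamMTopLawSide`) take the third field
`K♮ = Fix Θ` ABSTRACTLY through one binder block: a valued field `K'` (`[IsDiscreteValuationRing 𝒪[K']] [Finite 𝓀[K']]`, `#𝓀[K'] = q = #𝓀[M]`), an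
involution `σ'` whose fixed elements have even order (`hfix'`), a uniformiser `π'` with `|π' − σ'π'| = |π'|^{d'}` (`hdd'`), and an ORDER-COMPATIBLE embedding
`jK : K' →+* K` (`hjle`) onto the `Θ`-fixed elements with `jK ∘ σ' = ρ ∘ jK` and `|jK π'| = exp(−2)` (`hjπ`).  ★ S2′-R
`Literature.NumberTheory.LocalFields.ValuedFixedFieldRamified.exists_valuedFixedField_ramified` (LH4-p12 (g5), route (b′): `K' := Fix Θ` as a type with the
halved valuation) produces such a field once `Θ` is residually trivial and its fixed elements have even order.

THIS FILE assembles EXACTLY the T5c block (`exists_thirdFieldPackage_ramM`) from the frame's one-field letters: the Θ-datum `(Θ, ϖ, dΘ, tΘ)` (involution,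
isometry, `|ϖ| = exp(−1)`, even order of fixed elements), `ρ` an isometric involution commuting with `Θ`, and THREE case letters of type RamM — `hΘres`
(Θ residually trivial on `𝒪_M`: `M∕K♮` ramified), `hfixF` (doubly fixed elements have order in `4ℤ`: `e(M∕F) = 4`), and `hdK` (the `ρ`-depth of
`P := ϖ·Θϖ`, i.e. the different exponent `d'` of `σ'` read in `M`).  The three derived clauses: `hfix'` from `hfixF` and `hdd'` from `hdK`, both read
through the order isomorphism against powers of `π'` (no square roots in `ℤᵐ⁰`), and `hjπ` from `jK π' = P`.
HONEST LABEL: HC_CM is proved only modulo the 7 printed citations (2 remaining named inputs: hLiu418 = stmt-HodgeConjecture-24832,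
h413 = stmt-HodgeConjecture-24833) until rung 0 closes; (ρ2b′-X) :418 is an OPEN prover target — this file is a helper (`--supports`), proofs only, closes no socket.
-/

set_option autoImplicit false

open WithZero IsLocalRing
open scoped Valued

namespace Summit.HodgeConjecture.HodgeConjecture.Cruxes.H413.F0P3cDyRamToricLevelCensusRamMAtThirdField

open Literature.NumberTheory.LocalFields.ValuedFixedFieldRamified (exists_valuedFixedField_ramified)
open Literature.NumberTheory.Automorphic.UnitaryThreeFourFrame (IsRamifiedQuadraticDatum)

variable {K : Type} [Field K] [Valued K ℤᵐ⁰] {ρ Θ : K →+* K}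

/-! ## §0 Reading valuations through an order-compatible embedding -/

section OrderIso

variable {K' : Type*} [Field K'] [Valued K' ℤᵐ⁰]

/-- Equal valuations downstairs from equal valuations upstairs, through an order-compatible embedding. [cite: Serre1979, Ch. II §3] -/
theorem v_eq_of_v_map_eq (jK : K' →+* K) (hjle : ∀ x y : K', Valued.v (jK x) ≤ Valued.v (jK y) ↔ Valued.v x ≤ Valued.v y)
    {x y : K'} (h : Valued.v (jK x) = Valued.v (jK y)) : Valued.v x = Valued.v y :=
  le_antisymm ((hjle x y).1 h.le) ((hjle y x).1 h.ge)

/-- Integer powers of a normalised uniformiser: `|π'ᵏ| = exp(−k)`. [cite: Serre1979, Ch. II §1] -/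
theorem v_zpow_of_v_eq_exp_neg_one {π' : K'} (hπ' : Valued.v π' = exp (-1 : ℤ)) (k : ℤ) : Valued.v (π' ^ k) = exp (-k) := by
  rw [map_zpow₀, hπ', ← exp_zsmul, smul_eq_mul, mul_neg, mul_one]

/-- Integer powers of an element of valuation `exp(−2)`: `|Pᵏ| = exp(−2k)`. [cite: Serre1979, Ch. II §1] -/
theorem v_zpow_of_v_eq_exp_neg_two {P : K} (hP : Valued.v P = exp (-2 : ℤ)) (k : ℤ) : Valued.v (P ^ k) = exp (-(2 * k)) := by
  rw [map_zpow₀, hP, ← exp_zsmul, smul_eq_mul]; congr 1; ring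

end OrderIso

/-! ## §1 The type-RamM third-field package at the T5c letters -/

/-- **THE TYPE-RamM THIRD-FIELD PACKAGE AT THE T5c LETTERS.**  In the one-field frame of type RamM — a ramified Θ-datum `(Θ, ϖ, dΘ, tΘ)` on the complete
field `K = M` with finite residue field, `ρ` an isometric involution commuting with `Θ` — with `Θ` residually trivial (`hΘres`), doubly fixed elements of
order in `4ℤ` (`hfixF`), and the `ρ`-depth `|P − ρP| = exp(−2d')` of `P := ϖ·Θϖ` (`hdK`): there is a complete discretely valued field `K'` with
`#𝓀[K'] = #𝓀[K]`, an isometric involution `σ'` whose fixed elements have even order, a uniformiser `π'` with `|π' − σ'π'| = |π'|^{d'}`, and an order-compatible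
`jK : K' →+* K` onto the `Θ`-fixed elements with `jK ∘ σ' = ρ ∘ jK`, `|jK π'| = exp(−2)`, `jK π' = P` — the binder block of the ★ T5c heads VERBATIM.
Note for the welder: the letter `hdK` presupposes `ρP ≠ P` (`|0| ≠ exp`), i.e. the uniformiser `P` of `K♮ = Fix Θ` is not `ρ`-fixed — automatic in the RamM frame,
where `K♮ ⊄ E = Fix ρ` and `σ' = ρ|K♮` is a ramified involution (`d' ≥ 1`). [cite: Serre1979, Ch. II §3, Ch. III §5] -/
theorem exists_thirdFieldPackage_ramM [CompleteSpace K] [Finite 𝓀[K]]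
    (hρρ : ∀ x, ρ (ρ x) = x) (hvρ : ∀ x, Valued.v (ρ x) = Valued.v x) (hΘρ : ∀ x, Θ (ρ x) = ρ (Θ x))
    {ϖ : K} {dΘ tΘ : ℕ} (hDΘ : IsRamifiedQuadraticDatum Θ ϖ dΘ tΘ)
    (hΘres : ∀ x : K, Valued.v x ≤ 1 → Valued.v (x - Θ x) < 1)
    (hfixF : ∀ z : K, ρ z = z → Θ z = z → z ≠ 0 → ∃ n : ℤ, Valued.v z = exp (4 * n))
    {d' : ℕ} (hdK : Valued.v (ϖ * Θ ϖ - ρ (ϖ * Θ ϖ)) = exp (-(2 * (d' : ℤ)))) :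
    ∃ (K' : Type) (_ : Field K') (_ : Valued K' ℤᵐ⁰) (σ' : K' →+* K') (π' : K') (jK : K' →+* K),
      IsDiscreteValuationRing 𝒪[K'] ∧ Finite 𝓀[K'] ∧ Nat.card 𝓀[K'] = Nat.card 𝓀[K] ∧ CompleteSpace K' ∧
      (∀ x, σ' (σ' x) = x) ∧ (∀ x, Valued.v (σ' x) = Valued.v x) ∧
      (∀ x : K', σ' x = x → x ≠ 0 → ∃ n : ℤ, Valued.v x = exp (2 * n)) ∧
      Valued.v π' = exp (-1 : ℤ) ∧ Valued.v (π' - σ' π') = Valued.v π' ^ d' ∧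
      (∀ x y : K', Valued.v (jK x) ≤ Valued.v (jK y) ↔ Valued.v x ≤ Valued.v y) ∧
      (∀ x, Θ (jK x) = jK x) ∧ (∀ z : K, Θ z = z → ∃ x, jK x = z) ∧ (∀ x, jK (σ' x) = ρ (jK x)) ∧
      Valued.v (jK π') = exp (-2 : ℤ) ∧ jK π' = ϖ * Θ ϖ := by
  obtain ⟨hΘΘ, hvΘ, hϖ, hev, -, -, -⟩ := hDΘ
  have hΘP : Θ (ϖ * Θ ϖ) = ϖ * Θ ϖ := by rw [map_mul, hΘΘ, mul_comm]
  have hP : Valued.v (ϖ * Θ ϖ) = exp (-2 : ℤ) := by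
    rw [map_mul, hvΘ, hϖ, ← exp_add]; norm_num
  obtain ⟨K', _iF, _iV, σ', π', jK, hDVR, hfin, hcard, hcs, hσ', hvσ', -, hjle, hjΘ, hjfix, hjσ, hπ', hjπ', hres⟩ :=
    exists_valuedFixedField_ramified hΘΘ hvΘ hΘres hev hρρ hvρ hΘρ hΘP hP
  have hvjπ : Valued.v (jK π') = exp (-2 : ℤ) := by rw [hjπ', hP]
  refine ⟨K', _iF, _iV, σ', π', jK, hDVR, hfin, hcard, hcs, hσ', hvσ', ?_, hπ', ?_, hjle, hjΘ, hjfix, hjσ, hvjπ, hjπ'⟩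
  · -- `hfix'`: a `σ'`-fixed `x` maps to a doubly fixed `jK x`, of order `4n` upstairs, hence `x` has order `2n` downstairs
    intro x hx hx0
    have hρz : ρ (jK x) = jK x := by rw [← hjσ, hx]
    obtain ⟨n, hn⟩ := hfixF (jK x) hρz (hjΘ x) ((map_ne_zero jK).2 hx0)
    refine ⟨n, ?_⟩
    have h : Valued.v (jK x) = Valued.v (jK (π' ^ (-(2 * n)))) := by
      rw [hn, map_zpow₀ jK, v_zpow_of_v_eq_exp_neg_two hvjπ]; congr 1; ring
    rw [v_eq_of_v_map_eq jK hjle h, v_zpow_of_v_eq_exp_neg_one hπ']; congr 1; ring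
  · -- `hdd'`: `jK (π' − σ'π') = P − ρP` has order `2d'` upstairs, as does `jK (π'^{d'})`
    have h : Valued.v (jK (π' - σ' π')) = Valued.v (jK (π' ^ d')) := by
      rw [map_sub, hjσ, hjπ', hdK, map_pow, map_pow, hvjπ, ← exp_nsmul, nsmul_eq_mul]; congr 1; ring
    rw [v_eq_of_v_map_eq jK hjle h, map_pow]

end Summit.HodgeConjecture.HodgeConjecture.Cruxes.H413.F0P3cDyRamToricLevelCensusRamMAtThirdField
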